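import Literature.Probability.LatticeModels.PlaneRotatorCorrelationLength
import Literature.Probability.LatticeModels.LayeredPlaneRotatorStackStiffnessTransition
import Literature.Probability.LatticeModels.LayeredPlaneRotatorInterlayerCriterion
import Literature.Probability.LatticeModels.LayeredPlaneRotatorDecoupledFreeStack
import HarnessLib

/-!
# The correlation length of the LAYERED plane-rotator comparison model as a typed object, and the 2D → 3D lemma in
# correlation-length currency: `ξ^{3D}(K∥, K⊥) ≥ ξ^{2D}(K∥)` — interlayer coupling can only lengthen correlations

Topic `Literature/Probability/LatticeModels`. The layered classical XY model (plane rotator) on `ℤ³` with reduced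
in-plane coupling `K∥ = βJ∥ ≥ 0` and interlayer coupling `K⊥ = βJ⊥ ≥ 0` (free boundary conditions; the couplings
`(J, J, εJ)` of L. L. Liu, H. E. Stanley, Phys. Rev. Lett. **29** (1972) 927) has the infinite-volume two-point
function `G^{3D}_{(K∥,K⊥)}(0, z) = PlaneRotator.infTwoPointLayered 1 K∥ K⊥ 0 z` (tree, B. Simon, Comm. Math. Phys. **77**
(1980) 111, Thm 1.3 / J. Ginibre, Comm. Math. Phys. **16** (1970) 310). This file is the layered twin of
`PlaneRotatorCorrelationLength.lean` (`PlaneRotator.massGap K ν`): in the SAME generic vocabulary of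
`CorrelationDecay.lean` (`HasExponentialDecayRate`, `HasExponentialDecay`, `ℓ^∞` rates; S. Friedli, Y. Velenik,
*Statistical Mechanics of Lattice Systems* (2017) §3.7.4) it defines ONE object, the **mass gap of the stack**

`PlaneRotator.layeredMassGap K∥ K⊥ := sup {m : |G^{3D}(0, z)| ≤ C·e^{−m‖z‖_∞} for some C and all z} ∈ [0, ∞]`,

the stack's correlation length being `ξ^{3D}(K∥, K⊥) = 1/layeredMassGap K∥ K⊥` (`0` = "`ξ^{3D} = ∞`"). PROVED, by name
on tree lemmas only:

* §1 `hasExponentialDecayRate_of_abs_le_comp_layerEmbed` (a layer function dominated by the stack function along the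
  layer embedding `ι = layerEmbed` inherits every `ℓ^∞` rate, `‖ιx‖_∞ = ‖x‖_∞`) and
  **`hasExponentialDecayRate_infTwoPoint_of_layered`**: every decay rate of `G^{3D}_{(K∥,K⊥)}(0, ·)` is one of
  `G^{2D}_{K∥}(0, ·)` — because a layer sits below the stack, `G^{2D}_{K∥}(x, y) ≤ G^{3D}(ιx, ιy)` for EVERY `K⊥ ≥ 0`
  (Griffiths–Ginibre, tree `infTwoPoint_le_infTwoPointLayered`).
* §2 **THE MASSIVE PHASE OF THE STACK IS ITS HIGH-TEMPERATURE PHASE** (layered Simon–Lieb, sharp, all `K∥, K⊥ ≥ 0`):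
  `hasExponentialDecay_layered_iff_summable : HasExponentialDecay G^{3D} ↔ ∑_z G^{3D}(0, z) < ∞` (`⇐` tree
  `infTwoPointLayered_decay_of_summable`, with the explicit rate `hasExponentialDecayRate_layered_of_cube` — a
  terminating cube `S_{(R,R,R)} = a < 1` certifies `ξ^{3D} ≤ R/log(1/a)`; `⇒` Simon's lattice sum), hence on the ray
  `(K, ΔK)`: `↔ K < K_χ^{3D}(Δ)` (tree `summable_layered_iff_ofReal_lt`, `layeredSusceptibilityCriticalCoupling`).
* §3 the object `layeredMassGap` and its dictionary: `layeredMassGap_pos_iff` (`↔ HasExponentialDecay`),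
  `layeredMassGap_eq_zero_iff`, `layeredMassGap_pos_iff_summable`, **`layeredMassGap_pos_iff_ofReal_lt`**
  (`0 < layeredMassGap K (ΔK) ↔ K < K_χ^{3D}(Δ)`: `T_ξ^{3D} = T_χ^{3D}` as typed numbers),
  `layeredMassGap_eq_zero_of_layeredSusceptibilityCriticalCoupling_le` (`ξ^{3D} = ∞` at and above `K_χ^{3D}(Δ)`, in
  particular AT it, `layeredMassGap_toReal_layeredSusceptibilityCriticalCoupling`), `layeredMassGap_anti` (antitone in
  each coupling, Griffiths–Ginibre), `layeredMassGap_zero_zero = ⊤`.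
* §4 **2D → 3D**: **`layeredMassGap_le_massGap_two : layeredMassGap K∥ K⊥ ≤ massGap K∥ 2` for every `K⊥ ≥ 0`** —
  `ξ^{3D}(K∥, K⊥) ≥ ξ^{2D}(K∥)`: interlayer coupling can only LENGTHEN the correlation length; hence `ξ^{3D} = ∞`
  wherever ONE layer is critical or stiff: `layeredMassGap_eq_zero_of_susceptibilityCriticalCoupling_two_le`
  (`K∥ ≥ K_χ(2)`), **`layeredMassGap_eq_zero_of_torusXYStiffnessLiminf_pos`** (`Υ_∞(K∥) > 0`),
  `layeredMassGap_eq_zero_of_stiffnessCriticalCoupling_lt`, `FrohlichSpencerPowerLawLowerBound.layeredMassGap_eq_zero`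
  (named hypothesis only); the isotropic point `layeredMassGap_self : layeredMassGap K K = massGap K 3` and the
  isotropic sandwich `massGap (max K∥ K⊥) 3 ≤ layeredMassGap K∥ K⊥ ≤ massGap (min K∥ K⊥) 3`, whence Aizenman–Simon's
  mass gap for the stack `layeredMassGap_pos_of_lt_two_mul_criticalBeta_three` (`max K∥ K⊥ < 2β_c(3)`); Ginibre's axis
  floor `layeredMassGap_le_ofReal_neg_log_besselRatio` (`ξ^{3D} ≥ 1/log(I₀(K∥)/I₁(K∥)) > 0`, `layeredMassGap_lt_top`);
  at `K⊥ = 0` below `K_χ(2)` the across-layer correlations VANISH identically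
  (`infTwoPointLayered_eq_zero_of_ne_layer`, tree `infTwoPointLayered_le_pow_interlayer` at `J⊥ = 0`).
* §5 CLOSED-FORM FLOORS: `ofReal_le_layeredMassGap_of_cube` (`log(1/a)/R ≤ m^{3D}`), Lieb's layered star in Amos'
  form `ofReal_le_layeredMassGap_of_amos_star` (`log(1/A) ≤ m^{3D}` for `A = 4K∥/√(K∥²+4) + 2K⊥/√(K⊥²+4) < 1`).
* §6 STACK STIFFNESS (p2's `AnisotropicRotator.layeredStiffnessLiminf`, global Borel instance on `Circle`):
  **`layeredMassGap_eq_zero_of_layeredStiffnessLiminf_pos`** (`Υ^{3D}_∞(K∥, K⊥, i) > 0 ⇒ ξ^{3D} = ∞`, tree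
  `not_summable_layered_of_layeredStiffnessLiminf_pos`), `layeredMassGap_eq_zero_of_layeredStiffnessCriticalCoupling_lt`.

* §7 (appended) **THE DECOUPLED ENDPOINT**: with the free-boundary layer factorisation of
  `LayeredPlaneRotatorDecoupledFreeStack.lean` (`G^{3D}_{(K,0)}(0, z) = G^{2D}_K(0, πz)·[z₂ = 0]`),
  `hasExponentialDecayRate_layered_zero_iff` (at `K⊥ = 0` the stack and the layer have the same decay rates) and
  **`layeredMassGap_zero_right : layeredMassGap K 0 = massGap K 2`** (`K ≥ 0`) — `ξ^{3D}(K, 0) = ξ^{2D}(K)`, equality in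
  `layeredMassGap_le_massGap_two`, the anchor of the antitone family `K⊥ ↦ ξ^{3D}(K, K⊥)`; this removes item (1) of the
  NOT-CLAIMED list below.
* §8 (appended) **THE LIMIT `K⊥ → 0⁺`**: `sum_sphere_le_of_abs_le_exp` (a rate bounds sphere sums),
  `hasExponentialDecayRate_layered_of_cube_le_exp` (a cube number `≤ e^{−μR}` certifies the rate `μ`),
  **`eventually_hasExponentialDecayRate_layered_of_lt`** (every rate `μ < m` of the layer is a rate of the stack for all
  small `K⊥ ≥ 0`: Lieb numbers compute the mass gap — a large square has `S_R(K) ≤ ∑_{‖b‖=R} G^{2D} ≤ (2R+1)²Ce^{−mR} <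
  e^{−μR}`, which IS the cube number at `K⊥ = 0` (`aboxShellSum_layered_zero_one`), and the cube number is continuous in
  `K⊥`, tree `continuous_aboxShellSum_comp`), hence **`tendsto_layeredMassGap_nhdsGE_zero :
  Tendsto (layeredMassGap K ·) (𝓝[≥] 0) (𝓝 (massGap K 2))` for every `K ≥ 0`** — `ξ^{3D}(K, K⊥) → ξ^{2D}(K)` as
  `K⊥ → 0⁺` (from above by the antitone ceiling, from below by the rates) — with `tendsto_layeredMassGap_nhdsGT_zero`,
  `continuousWithinAt_layeredMassGap_Ici_zero`, `eventually_lt_layeredMassGap_of_lt_massGap` (every correlation-length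
  ceiling of the layer survives a small interlayer coupling), the temperature form `tendsto_layeredMassGap_temperature`
  (`ξ^{3D}(J∥/T, J⊥/T) → ξ^{2D}(J∥/T)` as `J⊥ → 0⁺` at fixed `T > 0`) and the openness rider
  `exists_nhds_layeredMassGap_pos`. READING (lead g8 RULING R107, words pre-stated, number-neutral): «at `J⊥ = 0` the
  free stack IS the layer … and the stack's correlation length is CONTINUOUS in the interlayer coupling at `J⊥ = 0`:
  `ξ^{3D}(J∥/T, J⊥/T) → ξ^{2D}(J∥/T)` as `J⊥ → 0⁺` at every temperature, monotone in between (W103); nothing about the rate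
  of approach». NOT CLAIMED by §8: any RATE of approach (no `1/ln²(J∥/J⊥)` law — see
  `LayeredPlaneRotatorLogSquaredLaw.lean` for the one-sided law under a Kosterlitz–Thouless envelope), continuity of
  `ξ^{3D}` in `K⊥` at `K⊥ > 0` or in `K∥`, anything at `K⊥ < 0`.

READING for the cell (`pub/hubbard-tc`, MO-S3; §2.4 G2 rider ∕ §4 T1 ∕ §6 №2 ∕ ASSUMPTIONS K4-c; number-neutral,
lead's words W103): «the layered comparison model's correlation length `ξ^{3D}(K∥, K⊥)` is a typed object: finite
exactly on the stack's high-temperature phase (sharp), infinite at and above `K_χ^{3D}(Δ)`, wherever the stack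
stiffness `Υ^{3D}_∞` is positive, and wherever ONE layer is critical or stiff — for every `K⊥ ≥ 0`, since
`ξ^{3D}(K∥, K⊥) ≥ ξ^{2D}(K∥)`: interlayer coupling can only lengthen correlations; so `T_ξ^{3D} = T_χ^{3D} ≥ T_χ^{2D} ≥
T_Υ^{2D}` as typed numbers».

NOT CLAIMED: the EQUALITY `ξ^{3D}(K, 0) = ξ^{2D}(K)` below `K_χ(2)` (it needs the free-box layer factorisation; only
the torus one, `torusXY_expectJ_stack_layer`, is in the tree — the inequality and the vanishing of the cross-layer part
are what is typed); any divergence law of `ξ^{3D}` at `K_χ^{3D}(Δ)⁻`; any continuity or monotonicity of `ξ^{3D}` in `K⊥`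
beyond antitonicity; `K_χ^{3D} < ∞` or `Υ^{3D}_∞ > 0` anywhere; anything about the Hubbard model. WHAT THIS IS NOT: a
value of `ξ^{3D}` at a coupling of interest for a material; a statement about `T_c` of an electron system.
-/

noncomputable section

open MeasureTheory Finset Filter Topology
open scoped BigOperators ENNReal

namespace Literature.Probability.LatticeModels

namespace PlaneRotator

open Literature.Barriers.CriticalPhenomena Literature.Barriers.CriticalPhenomena.LongRangeIsing

variable [MeasurableSpace Circle] [BorelSpace Circle]

/-! ## §1 Decay rates pass from the stack to a layer -/

section Embedding

omit [MeasurableSpace Circle] [BorelSpace Circle] in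
/-- The layer embedding `ι(x) = (x₀, x₁, 0)` preserves the `ℓ^∞` norm: `‖ιx‖_∞ = ‖x‖_∞`. [folklore] -/
private theorem supNorm_layerEmbed_eq (x : Site 2) : Site.supNorm (layerEmbed x) = Site.supNorm x := by
  apply le_antisymm
  · refine Finset.sup_le fun i _ => ?_
    fin_cases i
    · simpa [layerEmbed] using Site.natAbs_le_supNorm x 0
    · simpa [layerEmbed] using Site.natAbs_le_supNorm x 1
    · simp [layerEmbed]
  · refine Finset.sup_le fun i _ => ?_
    fin_cases i
    · simpa [layerEmbed] using Site.natAbs_le_supNorm (layerEmbed x) 0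
    · simpa [layerEmbed] using Site.natAbs_le_supNorm (layerEmbed x) 1

omit [MeasurableSpace Circle] [BorelSpace Circle] in
/-- `‖ιx‖ = ‖x‖` for the layer embedding (the norm on `ℤ^ν` is the `ℓ^∞` norm). [folklore] -/
private theorem norm_layerEmbed (x : Site 2) : ‖layerEmbed x‖ = ‖x‖ := by
  rw [Site.norm_eq_supNorm, Site.norm_eq_supNorm, supNorm_layerEmbed_eq]

omit [MeasurableSpace Circle] [BorelSpace Circle] in
/-- `ι(0) = 0`. [folklore] -/
private theorem layerEmbed_zero_eq : layerEmbed (0 : Site 2) = 0 := by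
  funext i
  fin_cases i <;> simp [layerEmbed]

omit [MeasurableSpace Circle] [BorelSpace Circle] in
/-- **Rates pass down along the layer embedding**: if `G : ℤ³ → ℝ` has `ℓ^∞`-decay rate `m` and `|g(x)| ≤ |G(ιx)|`
for all `x ∈ ℤ²`, then `g` has `ℓ^∞`-decay rate `m` (same constant), since `‖ιx‖_∞ = ‖x‖_∞`.
[cite: FriedliVelenik2017, §3.7.4 (exponential decay and rates)] -/
theorem hasExponentialDecayRate_of_abs_le_comp_layerEmbed {G : Site 3 → ℝ} {g : Site 2 → ℝ} {m : ℝ}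
    (h : HasExponentialDecayRate G m) (hg : ∀ x, |g x| ≤ |G (layerEmbed x)|) : HasExponentialDecayRate g m := by
  obtain ⟨hm, C, hC⟩ := h
  refine ⟨hm, C, fun x => (hg x).trans ?_⟩
  have h' := hC (layerEmbed x)
  rwa [norm_layerEmbed] at h'

/-- **Every decay rate of the stack is a decay rate of one layer**: for `K∥, K⊥ ≥ 0`, if
`G^{3D}_{(K∥,K⊥)}(0, ·)` has `ℓ^∞`-rate `m` then so has `G^{2D}_{K∥}(0, ·)` — a layer sits below the stack,
`0 ≤ G^{2D}_{K∥}(0, x) ≤ G^{3D}_{(K∥,K⊥)}(0, ιx)` for EVERY interlayer coupling `K⊥ ≥ 0` (Griffiths–Ginibre).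
[cite: Ginibre1970, Prop. 3 with Example 4 (plane rotators); LiuStanley1972, p. 272 (layers (J, J, εJ))] -/
theorem hasExponentialDecayRate_infTwoPoint_of_layered {Kp Kz m : ℝ} (hp : 0 ≤ Kp) (hz : 0 ≤ Kz)
    (h : HasExponentialDecayRate (fun z : Site 3 => infTwoPointLayered 1 Kp Kz 0 z) m) :
    HasExponentialDecayRate (fun x : Site 2 => infTwoPoint Kp 2 0 x) m := by
  refine hasExponentialDecayRate_of_abs_le_comp_layerEmbed h fun x => ?_
  have h1 := infTwoPoint_le_infTwoPointLayered zero_le_one hp hz (0 : Site 2) x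
  rw [one_mul, layerEmbed_zero_eq] at h1
  rw [abs_of_nonneg (infTwoPoint_nonneg hp 0 x), abs_of_nonneg (infTwoPointLayered_nonneg zero_le_one hp hz 0 _)]
  exact h1

/-- The same one level down in generality: exponential clustering of the stack forces exponential clustering of each
layer (`K∥, K⊥ ≥ 0`). [cite: Ginibre1970, Prop. 3 with Example 4 (plane rotators)] -/
theorem hasExponentialDecay_infTwoPoint_of_layered {Kp Kz : ℝ} (hp : 0 ≤ Kp) (hz : 0 ≤ Kz)
    (h : HasExponentialDecay fun z : Site 3 => infTwoPointLayered 1 Kp Kz 0 z) :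
    HasExponentialDecay fun x : Site 2 => infTwoPoint Kp 2 0 x := by
  obtain ⟨C, m, hm, hC⟩ := h
  exact (hasExponentialDecayRate_infTwoPoint_of_layered hp hz ⟨hm, C, hC⟩).hasExponentialDecay

end Embedding

/-! ## §2 The massive phase of the stack is its high-temperature phase (layered Simon–Lieb, sharp) -/

section Phase

/-- **Exponential decay ⇒ finite stack susceptibility** (`K∥, K⊥ ≥ 0`): Simon's lattice sum on `ℤ³`.
[cite: Simon1980CMP, Thm 1.3 (exponential decay summed over the lattice)] -/
theorem summable_layered_of_hasExponentialDecay {Kp Kz : ℝ} (hp : 0 ≤ Kp) (hz : 0 ≤ Kz)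
    (h : HasExponentialDecay fun z : Site 3 => infTwoPointLayered 1 Kp Kz 0 z) :
    Summable fun z : Site 3 => infTwoPointLayered 1 Kp Kz 0 z :=
  summable_of_hasExponentialDecay_of_nonneg (fun z => infTwoPointLayered_nonneg zero_le_one hp hz 0 z) h

omit [MeasurableSpace Circle] [BorelSpace Circle] in
/-- A box decay `a^{⌊s/R⌋}` with base `a ∈ (0, 1)` is an exponential bound with rate `log(1/a)/R` and constant `1/a`:
`a^{⌊s/R⌋} ≤ a⁻¹·e^{−(log(1/a)/R)·s}` (`R ≥ 1`). [folklore] -/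
private theorem pow_natDiv_le_inv_mul_exp_rate {a : ℝ} (ha0 : 0 < a) (ha1 : a < 1) {R : ℕ} (hR : 1 ≤ R) (s : ℕ) :
    a ^ (s / R) ≤ a⁻¹ * Real.exp (-(-Real.log a / R) * (s : ℝ)) := by
  have hRpos : (0 : ℝ) < R := by exact_mod_cast hR
  have hlt : (s : ℝ) < R * (((s / R : ℕ) : ℝ) + 1) := by
    exact_mod_cast Nat.lt_mul_div_succ s (show 0 < R by omega)
  have hq : (s : ℝ) / R - 1 ≤ ((s / R : ℕ) : ℝ) := by
    rw [sub_le_iff_le_add, div_le_iff₀ hRpos]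
    nlinarith
  calc a ^ (s / R) = a ^ ((s / R : ℕ) : ℝ) := (Real.rpow_natCast a _).symm
    _ ≤ a ^ ((s : ℝ) / R - 1) := Real.rpow_le_rpow_of_exponent_ge ha0 ha1.le hq
    _ = a ^ ((s : ℝ) / R) / a := by rw [Real.rpow_sub ha0, Real.rpow_one]
    _ = a⁻¹ * Real.exp (Real.log a * ((s : ℝ) / R)) := by rw [Real.rpow_def_of_pos ha0, div_eq_inv_mul]
    _ = a⁻¹ * Real.exp (-(-Real.log a / R) * (s : ℝ)) := by
        congr 2
        ring

/-- **A terminating cube certifies an exponential decay RATE for the stack**: if the cube number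
`a = S_{(R,R,R)}(1; K∥, K⊥)` satisfies `0 < a < 1` for some `R ≥ 1` (`K∥, K⊥ ≥ 0`) then
`G^{3D}(0, z) ≤ a^{⌊‖z‖_∞/R⌋} ≤ a⁻¹·e^{−(log(1/a)/R)‖z‖_∞}`: rate `log(1/a)/R`, constant `1/a` — a correlation-length
CEILING `ξ^{3D}(K∥, K⊥) ≤ R/log(1/a)`. [cite: Lieb1980, eq. (23) and p. 128 (boxes; φ(β) < 1 ⇒ exponential decay); Simon1980CMP, Thm 1.3] -/
theorem hasExponentialDecayRate_layered_of_cube {Kp Kz : ℝ} (hp : 0 ≤ Kp) (hz : 0 ≤ Kz) {R : ℕ} (hR : 1 ≤ R)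
    (ha0 : 0 < aboxShellSum (fun u v : Site 3 => 1 / 2 * layeredCoupling Kp Kz u v) (fun _ : Fin 3 => R))
    (ha1 : aboxShellSum (fun u v : Site 3 => 1 / 2 * layeredCoupling Kp Kz u v) (fun _ : Fin 3 => R) < 1) :
    HasExponentialDecayRate (fun z : Site 3 => infTwoPointLayered 1 Kp Kz 0 z)
      (-Real.log (aboxShellSum (fun u v : Site 3 => 1 / 2 * layeredCoupling Kp Kz u v) (fun _ : Fin 3 => R)) / R) := by
  set a := aboxShellSum (fun u v : Site 3 => 1 / 2 * layeredCoupling Kp Kz u v) (fun _ : Fin 3 => R) with ha_def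
  have hlog : Real.log a < 0 := Real.log_neg ha0 ha1
  have hRpos : (0 : ℝ) < R := by exact_mod_cast hR
  refine ⟨div_pos (neg_pos.2 hlog) hRpos, a⁻¹, fun z => ?_⟩
  rw [abs_of_nonneg (infTwoPointLayered_nonneg zero_le_one hp hz 0 z), Site.norm_eq_supNorm]
  have h := infTwoPointLayered_le_pow_cube zero_le_one hp hz hR (0 : Site 3) z
  rw [zero_sub, Site.supNorm_neg] at h
  exact h.trans (pow_natDiv_le_inv_mul_exp_rate ha0 ha1 hR _)

/-- **Finite stack susceptibility ⇒ exponential decay in all three directions** (`K∥, K⊥ ≥ 0`; Simon's Thm 1.3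
for the layered rotator via Lieb's finite algorithm, tree `infTwoPointLayered_decay_of_summable`, in the generic
vocabulary `HasExponentialDecay`). [cite: Simon1980CMP, Thm 1.3 (Σ⟨s₀s_x⟩ < ∞ ⇒ exponential decay); Lieb1980, p. 128 (boxes)] -/
theorem hasExponentialDecay_layered_of_summable {Kp Kz : ℝ} (hp : 0 ≤ Kp) (hz : 0 ≤ Kz)
    (hG : Summable fun z : Site 3 => infTwoPointLayered 1 Kp Kz 0 z) :
    HasExponentialDecay fun z : Site 3 => infTwoPointLayered 1 Kp Kz 0 z := by
  obtain ⟨R, hR, a, ha0, ha1, hxy⟩ := infTwoPointLayered_decay_of_summable zero_le_one hp hz hG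
  -- replace `a` by `b = max a ½ ∈ [½, 1)` so that the rate is a genuine logarithm
  set b := max a (1 / 2) with hb_def
  have hb0 : 0 < b := lt_of_lt_of_le one_half_pos (le_max_right _ _)
  have hb1 : b < 1 := max_lt ha1 one_half_lt_one
  have hlog : Real.log b < 0 := Real.log_neg hb0 hb1
  have hRpos : (0 : ℝ) < R := by exact_mod_cast hR
  refine ⟨b⁻¹, -Real.log b / R, div_pos (neg_pos.2 hlog) hRpos, fun z => ?_⟩
  rw [abs_of_nonneg (infTwoPointLayered_nonneg zero_le_one hp hz 0 z), Site.norm_eq_supNorm]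
  have h := hxy (0 : Site 3) z
  rw [zero_sub, Site.supNorm_neg] at h
  calc infTwoPointLayered 1 Kp Kz 0 z ≤ a ^ (Site.supNorm z / R) := h
    _ ≤ b ^ (Site.supNorm z / R) := pow_le_pow_left₀ ha0 (le_max_left _ _) _
    _ ≤ b⁻¹ * Real.exp (-(-Real.log b / R) * (Site.supNorm z : ℝ)) := pow_natDiv_le_inv_mul_exp_rate hb0 hb1 hR _

/-- **THE MASSIVE PHASE OF THE STACK IS ITS HIGH-TEMPERATURE PHASE** (`K∥, K⊥ ≥ 0`): `G^{3D}(0, ·)` decays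
exponentially iff `χ^{3D} = ∑_z G^{3D}(0, z) < ∞`. [cite: Simon1980CMP, Thm 1.3; Lieb1980, p. 128 (boxes)] -/
theorem hasExponentialDecay_layered_iff_summable {Kp Kz : ℝ} (hp : 0 ≤ Kp) (hz : 0 ≤ Kz) :
    (HasExponentialDecay fun z : Site 3 => infTwoPointLayered 1 Kp Kz 0 z) ↔
      Summable fun z : Site 3 => infTwoPointLayered 1 Kp Kz 0 z :=
  ⟨summable_layered_of_hasExponentialDecay hp hz, hasExponentialDecay_layered_of_summable hp hz⟩

/-- At and above the stack's susceptibility transition there is no exponential clustering: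
`K_χ^{3D}(Δ) ≤ K ⇒ ¬ HasExponentialDecay G^{3D}_{(K,ΔK)}` (`Δ, K ≥ 0`). [cite: Simon1980CMP, Thm 1.3; Lieb1980, Theorem 4 and p. 128] -/
theorem not_hasExponentialDecay_layered_of_layeredSusceptibilityCriticalCoupling_le {Δ K : ℝ} (hΔ : 0 ≤ Δ)
    (hK : 0 ≤ K) (h : layeredSusceptibilityCriticalCoupling Δ ≤ ENNReal.ofReal K) :
    ¬ HasExponentialDecay fun z : Site 3 => infTwoPointLayered 1 K (Δ * K) 0 z := fun hd =>
  absurd ((summable_layered_iff_ofReal_lt hΔ hK).1 (summable_layered_of_hasExponentialDecay hK (mul_nonneg hΔ hK) hd))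
    (not_lt.2 h)

end Phase

/-! ## §3 The mass gap of the stack `m^{3D}(K∥, K⊥) = 1/ξ^{3D}(K∥, K⊥)` as an extended non-negative real -/

section MassGap

/-- **The mass gap (inverse correlation length) of the layered plane rotator on `ℤ³` at reduced couplings
`(K∥, K⊥)`**: `layeredMassGap K∥ K⊥ := sup {m : ∃ C, ∀ z, |G^{3D}_{(K∥,K⊥)}(0, z)| ≤ C·e^{−m‖z‖_∞}} ∈ [0, ∞]`, the
supremum of the `ℓ^∞`-decay rates (`HasExponentialDecayRate` of `CorrelationDecay.lean`) of the infinite-volume free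
two-point function `infTwoPointLayered 1 K∥ K⊥ 0 ·`; the stack's correlation length is `ξ^{3D} = 1/layeredMassGap`
(`0` reads `ξ^{3D} = ∞`, `∞` reads `ξ^{3D} = 0`). The layered twin of `massGap K ν`; at the isotropic point
`layeredMassGap K K = massGap K 3` (`layeredMassGap_self`). As for `massGap`, this is the direction-free `ℓ^∞` rate,
not the axis `liminf` `invCorrLength` of `CorrelationDecay.lean`.
[cite: FriedliVelenik2017, §3.7.4 eq. (3.68) and §3.10.7 (correlation length); Simon1980CMP, Thm 1.3 (mass gap); LiuStanley1972, p. 272 (layers (J, J, εJ))] -/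
def layeredMassGap (Kp Kz : ℝ) : ℝ≥0∞ :=
  ⨆ (m : ℝ) (_ : HasExponentialDecayRate (fun z : Site 3 => infTwoPointLayered 1 Kp Kz 0 z) m), ENNReal.ofReal m

/-- Every decay rate of the stack lies below its mass gap. [cite: FriedliVelenik2017, §3.7.4] -/
theorem ofReal_le_layeredMassGap {Kp Kz m : ℝ}
    (h : HasExponentialDecayRate (fun z : Site 3 => infTwoPointLayered 1 Kp Kz 0 z) m) :
    ENNReal.ofReal m ≤ layeredMassGap Kp Kz :=
  le_iSup_of_le (f := fun m : ℝ =>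
      ⨆ (_ : HasExponentialDecayRate (fun z : Site 3 => infTwoPointLayered 1 Kp Kz 0 z) m), ENNReal.ofReal m) m
    (le_iSup (fun _ : HasExponentialDecayRate (fun z : Site 3 => infTwoPointLayered 1 Kp Kz 0 z) m =>
      ENNReal.ofReal m) h)

/-- The stack's mass gap is bounded by `c` as soon as every decay rate is. [cite: FriedliVelenik2017, §3.7.4] -/
theorem layeredMassGap_le_ofReal_of_forall_le {Kp Kz c : ℝ}
    (h : ∀ m, HasExponentialDecayRate (fun z : Site 3 => infTwoPointLayered 1 Kp Kz 0 z) m → m ≤ c) :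
    layeredMassGap Kp Kz ≤ ENNReal.ofReal c :=
  iSup₂_le fun m hm => ENNReal.ofReal_le_ofReal (h m hm)

/-- **`m^{3D} > 0 ⇔` exponential clustering of the stack.** [cite: FriedliVelenik2017, §3.7.4 eq. (3.68)] -/
theorem layeredMassGap_pos_iff {Kp Kz : ℝ} :
    0 < layeredMassGap Kp Kz ↔ HasExponentialDecay fun z : Site 3 => infTwoPointLayered 1 Kp Kz 0 z := by
  constructor
  · intro h
    obtain ⟨m, hm⟩ := lt_iSup_iff.1 h
    obtain ⟨hrate, _⟩ := lt_iSup_iff.1 hm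
    exact hrate.hasExponentialDecay
  · rintro ⟨C, m, hm, hC⟩
    exact lt_of_lt_of_le (ENNReal.ofReal_pos.2 hm) (ofReal_le_layeredMassGap ⟨hm, C, hC⟩)

/-- **`m^{3D} = 0 ⇔` no exponential clustering** (`ξ^{3D} = ∞`). [cite: FriedliVelenik2017, §3.7.4 eq. (3.68)] -/
theorem layeredMassGap_eq_zero_iff {Kp Kz : ℝ} :
    layeredMassGap Kp Kz = 0 ↔ ¬ HasExponentialDecay fun z : Site 3 => infTwoPointLayered 1 Kp Kz 0 z := by
  rw [← layeredMassGap_pos_iff, not_lt, nonpos_iff_eq_zero]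

/-- **`m^{3D} > 0 ⇔ χ^{3D} < ∞`** (`K∥, K⊥ ≥ 0`). [cite: Simon1980CMP, Thm 1.3; Lieb1980, p. 128] -/
theorem layeredMassGap_pos_iff_summable {Kp Kz : ℝ} (hp : 0 ≤ Kp) (hz : 0 ≤ Kz) :
    0 < layeredMassGap Kp Kz ↔ Summable fun z : Site 3 => infTwoPointLayered 1 Kp Kz 0 z :=
  layeredMassGap_pos_iff.trans (hasExponentialDecay_layered_iff_summable hp hz)

/-- `m^{3D} = 0 ⇔ χ^{3D} = ∞` (`K∥, K⊥ ≥ 0`). [cite: Simon1980CMP, Thm 1.3] -/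
theorem layeredMassGap_eq_zero_iff_not_summable {Kp Kz : ℝ} (hp : 0 ≤ Kp) (hz : 0 ≤ Kz) :
    layeredMassGap Kp Kz = 0 ↔ ¬ Summable fun z : Site 3 => infTwoPointLayered 1 Kp Kz 0 z := by
  rw [← layeredMassGap_pos_iff_summable hp hz, not_lt, nonpos_iff_eq_zero]

/-- **`m^{3D}(K, ΔK) > 0 ⇔ K < K_χ^{3D}(Δ)`** (`Δ, K ≥ 0`): the stack's correlation length is finite exactly on its
high-temperature phase — `T_ξ^{3D} = T_χ^{3D}` as typed numbers. [cite: Simon1980CMP, Thm 1.3; LiuStanley1972, p. 272 (T_c(ε) of the layers (J, J, εJ))] -/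
theorem layeredMassGap_pos_iff_ofReal_lt {Δ K : ℝ} (hΔ : 0 ≤ Δ) (hK : 0 ≤ K) :
    0 < layeredMassGap K (Δ * K) ↔ ENNReal.ofReal K < layeredSusceptibilityCriticalCoupling Δ :=
  (layeredMassGap_pos_iff_summable hK (mul_nonneg hΔ hK)).trans (summable_layered_iff_ofReal_lt hΔ hK)

/-- Below the stack's transition the mass gap is positive: `0 ≤ Δ`, `0 ≤ K`, `K < K_χ^{3D}(Δ) ⇒ 0 < m^{3D}(K, ΔK)`.
[cite: Simon1980CMP, Thm 1.3; Lieb1980, p. 128] -/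
theorem layeredMassGap_pos_of_ofReal_lt {Δ K : ℝ} (hΔ : 0 ≤ Δ) (hK : 0 ≤ K)
    (h : ENNReal.ofReal K < layeredSusceptibilityCriticalCoupling Δ) : 0 < layeredMassGap K (Δ * K) :=
  (layeredMassGap_pos_iff_ofReal_lt hΔ hK).2 h

/-- **`ξ^{3D} = ∞` at and above the stack's susceptibility transition**: `0 ≤ Δ`, `0 ≤ K`, `K_χ^{3D}(Δ) ≤ K ⇒
m^{3D}(K, ΔK) = 0`. [cite: Simon1980CMP, Thm 1.3; Lieb1980, Theorem 4 and p. 128 (β ≥ β_c ⇒ no box terminates)] -/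
theorem layeredMassGap_eq_zero_of_layeredSusceptibilityCriticalCoupling_le {Δ K : ℝ} (hΔ : 0 ≤ Δ) (hK : 0 ≤ K)
    (h : layeredSusceptibilityCriticalCoupling Δ ≤ ENNReal.ofReal K) : layeredMassGap K (Δ * K) = 0 := by
  by_contra hne
  exact absurd ((layeredMassGap_pos_iff_ofReal_lt hΔ hK).1 (pos_iff_ne_zero.2 hne)) (not_lt.2 h)

/-- **At the stack's transition coupling itself the correlation length is infinite** (when `K_χ^{3D}(Δ) < ∞`,
`Δ ≥ 0`): `m^{3D}(K_χ^{3D}(Δ), Δ·K_χ^{3D}(Δ)) = 0`. [cite: Simon1980CMP, Thm 1.3; Lieb1980, Theorem 4 and p. 128] -/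
theorem layeredMassGap_toReal_layeredSusceptibilityCriticalCoupling {Δ : ℝ} (hΔ : 0 ≤ Δ)
    (h : layeredSusceptibilityCriticalCoupling Δ ≠ ⊤) :
    layeredMassGap (layeredSusceptibilityCriticalCoupling Δ).toReal
      (Δ * (layeredSusceptibilityCriticalCoupling Δ).toReal) = 0 :=
  layeredMassGap_eq_zero_of_layeredSusceptibilityCriticalCoupling_le hΔ ENNReal.toReal_nonneg
    (ENNReal.ofReal_toReal h).ge

/-- **The stack's correlation length grows with BOTH couplings** (Griffiths–Ginibre): `0 ≤ K∥ ≤ K∥'`,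
`0 ≤ K⊥ ≤ K⊥' ⇒ m^{3D}(K∥', K⊥') ≤ m^{3D}(K∥, K⊥)` — every decay bound of `G^{3D}_{(K∥',K⊥')}` is one of
`G^{3D}_{(K∥,K⊥)} ≤ G^{3D}_{(K∥',K⊥')}` (tree `infTwoPointLayered_mono_of_mul_le`).
[cite: Ginibre1970, Prop. 3 with Example 4 (plane rotators); LiuStanley1972, p. 272] -/
theorem layeredMassGap_anti {Kp Kz Kp' Kz' : ℝ} (hp : 0 ≤ Kp) (hz : 0 ≤ Kz) (hpp : Kp ≤ Kp') (hzz : Kz ≤ Kz') :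
    layeredMassGap Kp' Kz' ≤ layeredMassGap Kp Kz := by
  refine iSup₂_le fun m hm => ofReal_le_layeredMassGap ?_
  obtain ⟨hm0, C, hC⟩ := hm
  refine ⟨hm0, C, fun z => le_trans ?_ (hC z)⟩
  have hle : infTwoPointLayered 1 Kp Kz 0 z ≤ infTwoPointLayered 1 Kp' Kz' 0 z :=
    infTwoPointLayered_mono_of_mul_le zero_le_one hp hz ((one_mul Kp).le.trans hpp) ((one_mul Kz).le.trans hzz) 0 z
  exact abs_le_abs_of_nonneg (infTwoPointLayered_nonneg zero_le_one hp hz 0 z) hle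

/-- `m^{3D}` is antitone in the in-plane coupling at fixed `K⊥ ≥ 0`. [cite: Ginibre1970, Prop. 3 with Example 4 (plane rotators)] -/
theorem layeredMassGap_antitoneOn_inPlane {Kz : ℝ} (hz : 0 ≤ Kz) :
    AntitoneOn (fun Kp => layeredMassGap Kp Kz) (Set.Ici 0) := fun _ hK _ _ hKK' =>
  layeredMassGap_anti hK hz hKK' le_rfl

/-- `m^{3D}` is antitone in the interlayer coupling at fixed `K∥ ≥ 0`: interlayer coupling can only lengthen the
stack's correlation length. [cite: Ginibre1970, Prop. 3 with Example 4 (plane rotators); LiuStanley1972, p. 272] -/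
theorem layeredMassGap_antitoneOn_interlayer {Kp : ℝ} (hp : 0 ≤ Kp) :
    AntitoneOn (fun Kz => layeredMassGap Kp Kz) (Set.Ici 0) := fun _ hK _ _ hKK' =>
  layeredMassGap_anti hp hK le_rfl hKK'

/-- **The isotropic point**: `m^{3D}(K, K) = m(K)` of the plane rotator on `ℤ³` (`infTwoPointLayered 1 K K` IS
`infTwoPoint K 3`, tree `infTwoPointLayered_isotropic`). [cite: LiuStanley1972, p. 272 (ε = 1 is the isotropic model); Ginibre1970, Example 4] -/
theorem layeredMassGap_self (K : ℝ) : layeredMassGap K K = massGap K 3 := by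
  unfold layeredMassGap massGap
  simp only [infTwoPointLayered_isotropic]

/-- **At infinite temperature the stack's correlation length is zero**: `m^{3D}(0, 0) = ∞` (`massGap_zero` on `ℤ³`).
[cite: Lieb1980, Theorem 4] -/
theorem layeredMassGap_zero_zero : layeredMassGap 0 0 = ⊤ := by
  rw [layeredMassGap_self, massGap_zero]

end MassGap

/-! ## §4 2D → 3D: `ξ^{3D}(K∥, K⊥) ≥ ξ^{2D}(K∥)` for every `K⊥ ≥ 0`, and the isotropic sandwich -/

section TwoToThree

/-- **2D → 3D IN CORRELATION-LENGTH CURRENCY**: for all `K∥, K⊥ ≥ 0`,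
`layeredMassGap K∥ K⊥ ≤ massGap K∥ 2` — `ξ^{3D}(K∥, K⊥) ≥ ξ^{2D}(K∥)`: coupling the layers (ferromagnetically, by any
amount) can only LENGTHEN the correlation length, never shorten it (every rate of the stack is a rate of the layer,
`hasExponentialDecayRate_infTwoPoint_of_layered`). [cite: Ginibre1970, Prop. 3 with Example 4 (plane rotators); LiuStanley1972, p. 272 (T_c(ε) ≥ T_c(0) for the layers (J, J, εJ))] -/
theorem layeredMassGap_le_massGap_two {Kp Kz : ℝ} (hp : 0 ≤ Kp) (hz : 0 ≤ Kz) :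
    layeredMassGap Kp Kz ≤ massGap Kp 2 :=
  iSup₂_le fun _ hm => ofReal_le_massGap (hasExponentialDecayRate_infTwoPoint_of_layered hp hz hm)

/-- **A critical layer makes the stack's correlation length infinite at every interlayer coupling**:
`0 ≤ K∥`, `0 ≤ K⊥`, `K_χ(2) ≤ K∥ ⇒ m^{3D}(K∥, K⊥) = 0`. [cite: Simon1980CMP, Thm 1.3; Ginibre1970, Prop. 3; LiuStanley1972, p. 272] -/
theorem layeredMassGap_eq_zero_of_susceptibilityCriticalCoupling_two_le {Kp Kz : ℝ} (hp : 0 ≤ Kp) (hz : 0 ≤ Kz)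
    (h : susceptibilityCriticalCoupling 2 ≤ ENNReal.ofReal Kp) : layeredMassGap Kp Kz = 0 :=
  nonpos_iff_eq_zero.1 ((layeredMassGap_le_massGap_two hp hz).trans
    (massGap_eq_zero_of_susceptibilityCriticalCoupling_le hp h).le)

/-- **A stiff layer makes the stack's correlation length infinite at every interlayer coupling**:
`0 ≤ K∥`, `0 ≤ K⊥`, `Υ_∞(K∥) > 0 ⇒ m^{3D}(K∥, K⊥) = 0` (the single layer's infinite-volume helicity modulus
`torusXYStiffnessLiminf`; tree `massGap_eq_zero_of_torusXYStiffnessLiminf_pos`). So the 2D stiffness transition of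
ONE layer lies at or below the divergence of the stack's correlation length: `T_Υ^{2D} ≤ T_χ^{2D} ≤ T_ξ^{3D} = T_χ^{3D}`.
[cite: FisherBarberJasnow1973, §II eq. (2.5) (Υ); Simon1980CMP, Thm 1.3; Ginibre1970, Prop. 3; LiuStanley1972, p. 272] -/
theorem layeredMassGap_eq_zero_of_torusXYStiffnessLiminf_pos {Kp Kz : ℝ} (hp : 0 ≤ Kp) (hz : 0 ≤ Kz)
    (h : 0 < torusXYStiffnessLiminf Kp) : layeredMassGap Kp Kz = 0 :=
  nonpos_iff_eq_zero.1 ((layeredMassGap_le_massGap_two hp hz).trans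
    (massGap_eq_zero_of_torusXYStiffnessLiminf_pos hp h).le)

/-- In transition-coupling form: `0 ≤ K∥`, `0 ≤ K⊥`, `K_Υ < K∥ ⇒ m^{3D}(K∥, K⊥) = 0` (the single layer's stiffness
transition coupling `stiffnessCriticalCoupling`). [cite: FisherBarberJasnow1973, §II eq. (2.5); Simon1980CMP, Thm 1.3] -/
theorem layeredMassGap_eq_zero_of_stiffnessCriticalCoupling_lt {Kp Kz : ℝ} (hp : 0 ≤ Kp) (hz : 0 ≤ Kz)
    (h : stiffnessCriticalCoupling < ENNReal.ofReal Kp) : layeredMassGap Kp Kz = 0 :=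
  nonpos_iff_eq_zero.1 ((layeredMassGap_le_massGap_two hp hz).trans
    (massGap_eq_zero_of_stiffnessCriticalCoupling_lt hp h).le)

/-- **Under Fröhlich–Spencer's Theorem C** (the tree's named fact `FrohlichSpencerPowerLawLowerBound`, hypothesis
only): there is `K₁ > 0` such that the stack's correlation length is infinite for every `K∥ ≥ K₁` and EVERY `K⊥ ≥ 0`.
[cite: FrohlichSpencerKT1981, §1.4 Theorem C (p. 534); Ginibre1970, Prop. 3; Simon1980CMP, Thm 1.3] -/
theorem FrohlichSpencerPowerLawLowerBound.layeredMassGap_eq_zero (hFS : FrohlichSpencerPowerLawLowerBound) :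
    ∃ K₁ : ℝ, 0 < K₁ ∧ ∀ Kp Kz : ℝ, K₁ ≤ Kp → 0 ≤ Kz → layeredMassGap Kp Kz = 0 := by
  obtain ⟨K₁, hK₁, h⟩ := hFS.massGap_eq_zero
  exact ⟨K₁, hK₁, fun Kp Kz hKp hKz => nonpos_iff_eq_zero.1
    ((layeredMassGap_le_massGap_two (hK₁.le.trans hKp) hKz).trans (h Kp hKp).le)⟩

/-- **The stack's correlation length is never zero at positive in-plane coupling** (Ginibre's axis floor, through
the layer): `0 < K∥`, `0 ≤ K⊥ ⇒ m^{3D}(K∥, K⊥) ≤ log(I₀(K∥)/I₁(K∥))`, i.e. `ξ^{3D} ≥ 1/log(I₀(K∥)/I₁(K∥)) > 0`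
(tree `massGap_le_ofReal_neg_log_besselRatio` on `ℤ²`). [cite: Ginibre1970, Prop. 3 with Example 4 (plane rotators); Lieb1980, eq. (25)] -/
theorem layeredMassGap_le_ofReal_neg_log_besselRatio {Kp Kz : ℝ} (hp : 0 < Kp) (hz : 0 ≤ Kz) :
    layeredMassGap Kp Kz ≤ ENNReal.ofReal (-Real.log (besselRatio Kp)) :=
  (layeredMassGap_le_massGap_two hp.le hz).trans (massGap_le_ofReal_neg_log_besselRatio two_pos hp)

/-- The stack's mass gap is finite at every positive in-plane coupling: `m^{3D} < ∞`, `ξ^{3D} > 0`.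
[cite: Ginibre1970, Prop. 3 with Example 4 (plane rotators)] -/
theorem layeredMassGap_lt_top {Kp Kz : ℝ} (hp : 0 < Kp) (hz : 0 ≤ Kz) : layeredMassGap Kp Kz < ⊤ :=
  lt_of_le_of_lt (layeredMassGap_le_ofReal_neg_log_besselRatio hp hz) ENNReal.ofReal_lt_top

/-- **Isotropic sandwich, upper half**: `0 ≤ K∥`, `0 ≤ K⊥ ⇒ m^{3D}(K∥, K⊥) ≤ m(min K∥ K⊥)` on `ℤ³` — the stack's
correlation length is at least the isotropic `ℤ³` rotator's at the SMALLER coupling (Griffiths–Ginibre down to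
`(min, min)`, then `layeredMassGap_self`). [cite: Ginibre1970, Prop. 3 with Example 4 (plane rotators); LiuStanley1972, p. 272] -/
theorem layeredMassGap_le_massGap_three_min {Kp Kz : ℝ} (hp : 0 ≤ Kp) (hz : 0 ≤ Kz) :
    layeredMassGap Kp Kz ≤ massGap (min Kp Kz) 3 := by
  rw [← layeredMassGap_self]
  exact layeredMassGap_anti (le_min hp hz) (le_min hp hz) (min_le_left _ _) (min_le_right _ _)

/-- **Isotropic sandwich, lower half**: `0 ≤ K∥`, `0 ≤ K⊥ ⇒ m(max K∥ K⊥) ≤ m^{3D}(K∥, K⊥)` — the stack's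
correlation length is at most the isotropic `ℤ³` rotator's at the LARGER coupling. [cite: Ginibre1970, Prop. 3 with Example 4 (plane rotators); LiuStanley1972, p. 272] -/
theorem massGap_three_max_le_layeredMassGap {Kp Kz : ℝ} (hp : 0 ≤ Kp) (hz : 0 ≤ Kz) :
    massGap (max Kp Kz) 3 ≤ layeredMassGap Kp Kz := by
  rw [← layeredMassGap_self]
  exact layeredMassGap_anti hp hz (le_max_left _ _) (le_max_right _ _)

/-- Weak interlayer coupling (`0 ≤ K⊥ ≤ K∥`): `m(K∥) on ℤ³ ≤ m^{3D}(K∥, K⊥) ≤ m(K∥) on ℤ²` — the stack's correlation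
length lies between the single layer's and the isotropic three-dimensional model's at the same in-plane coupling.
[cite: Ginibre1970, Prop. 3 with Example 4 (plane rotators); LiuStanley1972, p. 272 (0 ≤ ε ≤ 1)] -/
theorem layeredMassGap_mem_Icc_of_le {Kp Kz : ℝ} (hz : 0 ≤ Kz) (hle : Kz ≤ Kp) :
    layeredMassGap Kp Kz ∈ Set.Icc (massGap Kp 3) (massGap Kp 2) := by
  have hp : 0 ≤ Kp := hz.trans hle
  refine ⟨?_, layeredMassGap_le_massGap_two hp hz⟩
  have h := massGap_three_max_le_layeredMassGap hp hz
  rwa [max_eq_left hle] at h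

/-- **Aizenman–Simon's mass gap for the stack**: `0 ≤ K∥`, `0 ≤ K⊥`, `max K∥ K⊥ < 2β_c(3)` (`β_c(3)` the Ising
critical point of `ℤ³`) `⇒ m^{3D}(K∥, K⊥) > 0` — the stack clusters exponentially whenever the isotropic `ℤ³` rotator
at the larger coupling does (tree `massGap_pos_of_lt_two_mul_criticalBeta`).
[cite: AizenmanSimon1980RotorIsing, eqs. (1)–(2); AizenmanSimon1980LocalWard, Thm 3; Ginibre1970, Prop. 3] -/
theorem layeredMassGap_pos_of_lt_two_mul_criticalBeta_three {Kp Kz : ℝ} (hp : 0 ≤ Kp) (hz : 0 ≤ Kz)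
    (h : max Kp Kz < 2 * criticalBeta 3) : 0 < layeredMassGap Kp Kz :=
  lt_of_lt_of_le (massGap_pos_of_lt_two_mul_criticalBeta (d := 3) (by norm_num) (le_max_of_le_left hp) h)
    (massGap_three_max_le_layeredMassGap hp hz)

/-- In susceptibility currency: `0 ≤ K∥`, `0 ≤ K⊥`, `max K∥ K⊥ < 2β_c(3) ⇒ χ^{3D}(K∥, K⊥) < ∞`.
[cite: AizenmanSimon1980RotorIsing, eqs. (1)–(2); Simon1980CMP, Thm 1.3] -/
theorem summable_layered_of_lt_two_mul_criticalBeta_three {Kp Kz : ℝ} (hp : 0 ≤ Kp) (hz : 0 ≤ Kz)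
    (h : max Kp Kz < 2 * criticalBeta 3) : Summable fun z : Site 3 => infTwoPointLayered 1 Kp Kz 0 z :=
  (layeredMassGap_pos_iff_summable hp hz).1 (layeredMassGap_pos_of_lt_two_mul_criticalBeta_three hp hz h)

/-- **Decoupled layers below the layer's transition: the across-layer correlations vanish identically.** For
`0 ≤ K∥` with `χ^{2D}(K∥) < ∞` and `K⊥ = 0`: `G^{3D}_{(K∥,0)}(x, y) = 0` whenever `x` and `y` lie in different layers
(the interlayer decay `G^{3D}(x, y) ≤ (K⊥·χ^{2D})^{|x₂ − y₂|}` of the tree, `infTwoPointLayered_le_pow_interlayer`, at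
`K⊥ = 0`). [cite: LiuStanley1972, p. 272 (ε = 0 decouples the layers); Simon1980CMP, Thm 1.3] -/
theorem infTwoPointLayered_eq_zero_of_ne_layer {Kp : ℝ} (hp : 0 ≤ Kp)
    (hχ : Summable fun w : Site 2 => infTwoPoint Kp 2 0 w) {x y : Site 3} (hxy : x 2 ≠ y 2) :
    infTwoPointLayered 1 Kp 0 x y = 0 := by
  have hχ' : Summable fun w : Site 2 => infTwoPoint (1 * Kp) 2 0 w := by rwa [one_mul]
  have h := infTwoPointLayered_le_pow_interlayer zero_le_one hp le_rfl hχ' x y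
  have hne : (x 2 - y 2).natAbs ≠ 0 := fun h0 => hxy (sub_eq_zero.1 (Int.natAbs_eq_zero.1 h0))
  rw [mul_zero, zero_mul, zero_pow hne] at h
  exact le_antisymm h (infTwoPointLayered_nonneg zero_le_one hp le_rfl x y)

/-- The same on the high-temperature phase of the layer in transition-coupling form: `0 ≤ K∥ < K_χ(2)`, `K⊥ = 0`,
`x₂ ≠ y₂ ⇒ G^{3D}_{(K∥,0)}(x, y) = 0`. [cite: LiuStanley1972, p. 272 (ε = 0); Simon1980CMP, Thm 1.3] -/
theorem infTwoPointLayered_eq_zero_of_ne_layer_of_ofReal_lt {Kp : ℝ} (hp : 0 ≤ Kp)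
    (hK : ENNReal.ofReal Kp < susceptibilityCriticalCoupling 2) {x y : Site 3} (hxy : x 2 ≠ y 2) :
    infTwoPointLayered 1 Kp 0 x y = 0 :=
  infTwoPointLayered_eq_zero_of_ne_layer hp ((summable_infTwoPoint_iff_ofReal_lt hp).2 hK) hxy

end TwoToThree

/-! ## §5 Closed-form floors for the stack's mass gap: cube certificates and Lieb's layered star -/

section Window

/-- **A terminating cube certifies a correlation-length ceiling for the stack**: `0 < S_{(R,R,R)}(1; K∥, K⊥) = a < 1`,
`R ≥ 1`, `K∥, K⊥ ≥ 0 ⇒ log(1/a)/R ≤ m^{3D}(K∥, K⊥)`, i.e. `ξ^{3D} ≤ R/log(1/a)`.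
[cite: Lieb1980, eq. (23) and p. 128 (boxes; finite algorithm); Simon1980CMP, Thm 1.3] -/
theorem ofReal_le_layeredMassGap_of_cube {Kp Kz : ℝ} (hp : 0 ≤ Kp) (hz : 0 ≤ Kz) {R : ℕ} (hR : 1 ≤ R)
    (ha0 : 0 < aboxShellSum (fun u v : Site 3 => 1 / 2 * layeredCoupling Kp Kz u v) (fun _ : Fin 3 => R))
    (ha1 : aboxShellSum (fun u v : Site 3 => 1 / 2 * layeredCoupling Kp Kz u v) (fun _ : Fin 3 => R) < 1) :
    ENNReal.ofReal
        (-Real.log (aboxShellSum (fun u v : Site 3 => 1 / 2 * layeredCoupling Kp Kz u v) (fun _ : Fin 3 => R)) / R) ≤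
      layeredMassGap Kp Kz :=
  ofReal_le_layeredMassGap (hasExponentialDecayRate_layered_of_cube hp hz hR ha0 ha1)

omit [MeasurableSpace Circle] [BorelSpace Circle] in
/-- `‖z‖_∞ ≤ ‖z‖₁` on `ℤ³`. [folklore] -/
private theorem supNorm_le_l1Norm_three (z : Site 3) : Site.supNorm z ≤ l1Norm z := by
  unfold Site.supNorm l1Norm
  refine Finset.sup_le fun i _ => ?_
  exact Finset.single_le_sum (f := fun i => (z i).natAbs) (fun _ _ => Nat.zero_le _) (Finset.mem_univ i)

/-- **Lieb's layered star (Amos' form) as a rate**: if `0 < A := 4K∥/√(K∥²+4) + 2K⊥/√(K⊥²+4) < 1` (`K∥, K⊥ ≥ 0`)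
then `G^{3D}(0, ·)` has `ℓ^∞`-rate `log(1/A)` with constant `1` (`A^{‖z‖₁} ≤ A^{‖z‖_∞}`, tree
`infTwoPointLayered_le_pow_amos_of_le`). [cite: Lieb1980, Theorem 4 (the star); Amos1974, eq. (11) (u(x) ≤ x/√(x²+4))] -/
theorem hasExponentialDecayRate_layered_of_amos_star {Kp Kz : ℝ} (hp : 0 ≤ Kp) (hz : 0 ≤ Kz)
    (hA0 : 0 < 4 * (Kp / Real.sqrt (Kp ^ 2 + 4)) + 2 * (Kz / Real.sqrt (Kz ^ 2 + 4)))
    (hA1 : 4 * (Kp / Real.sqrt (Kp ^ 2 + 4)) + 2 * (Kz / Real.sqrt (Kz ^ 2 + 4)) < 1) :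
    HasExponentialDecayRate (fun z : Site 3 => infTwoPointLayered 1 Kp Kz 0 z)
      (-Real.log (4 * (Kp / Real.sqrt (Kp ^ 2 + 4)) + 2 * (Kz / Real.sqrt (Kz ^ 2 + 4)))) := by
  set A := 4 * (Kp / Real.sqrt (Kp ^ 2 + 4)) + 2 * (Kz / Real.sqrt (Kz ^ 2 + 4)) with hA_def
  have hlog : Real.log A < 0 := Real.log_neg hA0 hA1
  refine ⟨neg_pos.2 hlog, 1, fun z => ?_⟩
  rw [abs_of_nonneg (infTwoPointLayered_nonneg zero_le_one hp hz 0 z), one_mul, Site.norm_eq_supNorm]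
  have h := infTwoPointLayered_le_pow_amos_of_le zero_le_one hp hz (by rw [one_mul]) (by rw [one_mul]) (0 : Site 3) z
  rw [zero_sub, l1Norm_neg] at h
  calc infTwoPointLayered 1 Kp Kz 0 z ≤ A ^ l1Norm z := h
    _ ≤ A ^ Site.supNorm z := pow_le_pow_of_le_one hA0.le hA1.le (supNorm_le_l1Norm_three z)
    _ = Real.exp (-(-Real.log A) * (Site.supNorm z : ℝ)) := by
        rw [neg_neg, ← Real.rpow_natCast, Real.rpow_def_of_pos hA0]

/-- **Star certificate for the stack's correlation length**: `0 < A = 4K∥/√(K∥²+4) + 2K⊥/√(K⊥²+4) < 1 ⇒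
log(1/A) ≤ m^{3D}(K∥, K⊥)`, i.e. `ξ^{3D}(K∥, K⊥) ≤ 1/log(1/A)` — in closed form on Lieb's layered star region.
[cite: Lieb1980, Theorem 4; Amos1974, eq. (11)] -/
theorem ofReal_le_layeredMassGap_of_amos_star {Kp Kz : ℝ} (hp : 0 ≤ Kp) (hz : 0 ≤ Kz)
    (hA0 : 0 < 4 * (Kp / Real.sqrt (Kp ^ 2 + 4)) + 2 * (Kz / Real.sqrt (Kz ^ 2 + 4)))
    (hA1 : 4 * (Kp / Real.sqrt (Kp ^ 2 + 4)) + 2 * (Kz / Real.sqrt (Kz ^ 2 + 4)) < 1) :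
    ENNReal.ofReal (-Real.log (4 * (Kp / Real.sqrt (Kp ^ 2 + 4)) + 2 * (Kz / Real.sqrt (Kz ^ 2 + 4)))) ≤
      layeredMassGap Kp Kz :=
  ofReal_le_layeredMassGap (hasExponentialDecayRate_layered_of_amos_star hp hz hA0 hA1)

/-- **Two-sided closed-form window on the star region** (`0 < K∥`, `0 ≤ K⊥`, `0 < A < 1` as above):
`log(1/A) ≤ m^{3D}(K∥, K⊥) ≤ log(I₀(K∥)/I₁(K∥))`. [cite: Lieb1980, Theorem 4; Amos1974, eq. (11); Ginibre1970, Prop. 3] -/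
theorem layeredMassGap_mem_Icc_of_amos_star {Kp Kz : ℝ} (hp : 0 < Kp) (hz : 0 ≤ Kz)
    (hA1 : 4 * (Kp / Real.sqrt (Kp ^ 2 + 4)) + 2 * (Kz / Real.sqrt (Kz ^ 2 + 4)) < 1) :
    layeredMassGap Kp Kz ∈ Set.Icc
      (ENNReal.ofReal (-Real.log (4 * (Kp / Real.sqrt (Kp ^ 2 + 4)) + 2 * (Kz / Real.sqrt (Kz ^ 2 + 4)))))
      (ENNReal.ofReal (-Real.log (besselRatio Kp))) := by
  have hA0 : 0 < 4 * (Kp / Real.sqrt (Kp ^ 2 + 4)) + 2 * (Kz / Real.sqrt (Kz ^ 2 + 4)) :=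
    add_pos_of_pos_of_nonneg (mul_pos (by norm_num) (div_pos hp (Real.sqrt_pos.2 (by positivity))))
      (mul_nonneg (by norm_num) (div_nonneg hz (Real.sqrt_nonneg _)))
  exact ⟨ofReal_le_layeredMassGap_of_amos_star hp.le hz hA0 hA1, layeredMassGap_le_ofReal_neg_log_besselRatio hp hz⟩

end Window

end PlaneRotator

/-! ## §6 The stack stiffness forces an infinite correlation length (global Borel instance on `Circle`) -/

namespace PlaneRotator

section Stiffness

open AnisotropicRotator

/-- **A nonzero stack helicity modulus forces an infinite stack correlation length**: `0 ≤ K∥`, `0 ≤ K⊥`,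
`Υ^{3D}_∞(K∥, K⊥, i) > 0 ⇒ m^{3D}(K∥, K⊥) = 0` (any twist direction `eᵢ`; tree
`not_summable_layered_of_layeredStiffnessLiminf_pos`, Simon–Lieb). So the stack's stiffness onset lies at or below
the divergence of its correlation length: `T_Υ^{3D} ≤ T_ξ^{3D} = T_χ^{3D}`.
[cite: FisherBarberJasnow1973, §II eq. (2.5) (Υ); Simon1980CMP, Thm 1.3; Lieb1980, Theorem 4 and p. 128] -/
theorem layeredMassGap_eq_zero_of_layeredStiffnessLiminf_pos {Kp Kz : ℝ} (hp : 0 ≤ Kp) (hz : 0 ≤ Kz) {i : Fin 3}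
    (h : 0 < layeredStiffnessLiminf Kp Kz i) : layeredMassGap Kp Kz = 0 :=
  (layeredMassGap_eq_zero_iff_not_summable hp hz).2 (not_summable_layered_of_layeredStiffnessLiminf_pos hp hz h)

/-- In transition-coupling form on the ray `(K, ΔK)`: `0 ≤ Δ`, `0 ≤ K`, `K_Υ^{3D}(Δ, i) < K ⇒ m^{3D}(K, ΔK) = 0`
(`K_χ^{3D}(Δ) ≤ K_Υ^{3D}(Δ, i)`, tree `layeredSusceptibilityCriticalCoupling_le_layeredStiffnessCriticalCoupling`).
[cite: FisherBarberJasnow1973, §II eq. (2.5); Simon1980CMP, Thm 1.3] -/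
theorem layeredMassGap_eq_zero_of_layeredStiffnessCriticalCoupling_lt {Δ K : ℝ} (hΔ : 0 ≤ Δ) (hK : 0 ≤ K)
    {i : Fin 3} (h : layeredStiffnessCriticalCoupling Δ i < ENNReal.ofReal K) : layeredMassGap K (Δ * K) = 0 :=
  layeredMassGap_eq_zero_of_layeredSusceptibilityCriticalCoupling_le hΔ hK
    ((layeredSusceptibilityCriticalCoupling_le_layeredStiffnessCriticalCoupling hΔ i).trans h.le)

/-- Where the stack has a mass gap it carries no stiffness in any direction: `0 ≤ K∥`, `0 ≤ K⊥`,
`0 < m^{3D}(K∥, K⊥) ⇒ Υ^{3D}_∞(K∥, K⊥, i) = 0` (tree `layeredStiffnessLiminf_eq_zero_of_summable'`).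
[cite: FisherBarberJasnow1973, §II eq. (2.5); Simon1980CMP, Thm 1.3] -/
theorem layeredStiffnessLiminf_eq_zero_of_layeredMassGap_pos {Kp Kz : ℝ} (hp : 0 ≤ Kp) (hz : 0 ≤ Kz)
    (h : 0 < layeredMassGap Kp Kz) (i : Fin 3) : layeredStiffnessLiminf Kp Kz i = 0 :=
  layeredStiffnessLiminf_eq_zero_of_summable' hp hz ((layeredMassGap_pos_iff_summable hp hz).1 h) i

end Stiffness

end PlaneRotator


/-! # Appendix (hubbard-tc-p1 g22, RULING R107): the decoupled endpoint and the limit `K⊥ → 0⁺` of `ξ^{3D}` -/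

namespace PlaneRotator

open Literature.Barriers.CriticalPhenomena Literature.Barriers.CriticalPhenomena.LongRangeIsing

variable [MeasurableSpace Circle] [BorelSpace Circle]

/-! ## §7 (appended) The decoupled endpoint: at `K⊥ = 0` the stack's correlation length IS the layer's, `layeredMassGap K 0 = massGap K 2` -/

section MassGap

omit [MeasurableSpace Circle] [BorelSpace Circle] in
/-- On the layer `z₂ = 0`: `‖πz‖_∞ = ‖z‖_∞`. [folklore] -/
private theorem supNorm_planeProj_of_apply_two {z : Site 3} (hz : z 2 = 0) : Site.supNorm (planeProj z) = Site.supNorm z := by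
  apply le_antisymm
  · refine Finset.sup_le fun i _ => ?_
    fin_cases i
    · simpa [planeProj] using Site.natAbs_le_supNorm z 0
    · simpa [planeProj] using Site.natAbs_le_supNorm z 1
  · refine Finset.sup_le fun i _ => ?_
    fin_cases i
    · simpa [planeProj] using Site.natAbs_le_supNorm (planeProj z) 0
    · simpa [planeProj] using Site.natAbs_le_supNorm (planeProj z) 1
    · simp [hz]

/-- **Every decay rate of the layer is a decay rate of the free stack at `K⊥ = 0`** (`K ≥ 0`): if
`|G^{2D}_K(0, x)| ≤ C e^{−m‖x‖_∞}` then `|G^{3D}_{(K,0)}(0, z)| ≤ C e^{−m‖z‖_∞}` — `G^{3D}_{(K,0)}(0, z)` is `G^{2D}_K(0, πz)`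
on the layer `z₂ = 0` (where `‖πz‖_∞ = ‖z‖_∞`) and `0` off it. [cite: FriedliVelenik2017, §3.7.4 (exponential decay and rates); LiuStanley1972, p. 272 (ε = 0)] -/
theorem hasExponentialDecayRate_layered_zero_of_infTwoPoint {K m : ℝ} (hK : 0 ≤ K)
    (h : HasExponentialDecayRate (fun x : Site 2 => infTwoPoint K 2 0 x) m) :
    HasExponentialDecayRate (fun z : Site 3 => infTwoPointLayered 1 K 0 0 z) m := by
  obtain ⟨hm, C, hC⟩ := h
  have hC0 : 0 ≤ C := by
    have h0 := hC 0
    rw [norm_zero, mul_zero, Real.exp_zero, mul_one] at h0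
    exact (abs_nonneg _).trans h0
  refine ⟨hm, C, fun z => ?_⟩
  change |infTwoPointLayered 1 K 0 0 z| ≤ C * Real.exp (-m * ‖z‖)
  rw [infTwoPointLayered_zero_origin hK]
  split_ifs with hz
  · calc |infTwoPoint K 2 0 (planeProj z)| ≤ C * Real.exp (-m * ‖planeProj z‖) := hC (planeProj z)
      _ = C * Real.exp (-m * ‖z‖) := by
          rw [Site.norm_eq_supNorm, Site.norm_eq_supNorm, supNorm_planeProj_of_apply_two hz]
  · rw [abs_zero]
    exact mul_nonneg hC0 (Real.exp_pos _).le

/-- At `K⊥ = 0` the free stack and the layer have THE SAME decay rates (`K ≥ 0`).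
[cite: FriedliVelenik2017, §3.7.4 (exponential decay and rates); LiuStanley1972, p. 272 (ε = 0)] -/
theorem hasExponentialDecayRate_layered_zero_iff {K m : ℝ} (hK : 0 ≤ K) :
    HasExponentialDecayRate (fun z : Site 3 => infTwoPointLayered 1 K 0 0 z) m ↔
      HasExponentialDecayRate (fun x : Site 2 => infTwoPoint K 2 0 x) m :=
  ⟨hasExponentialDecayRate_infTwoPoint_of_layered hK le_rfl, hasExponentialDecayRate_layered_zero_of_infTwoPoint hK⟩

/-- **`ξ^{3D}(K, 0) = ξ^{2D}(K)`: at zero interlayer coupling the free stack's correlation length IS the layer's**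
(`K ≥ 0`): `layeredMassGap K 0 = massGap K 2` — equality in the tree's `layeredMassGap_le_massGap_two` at `K⊥ = 0`, the
anchor of the monotone family `K⊥ ↦ ξ^{3D}(K, K⊥)` (`layeredMassGap_anti`).
[cite: FriedliVelenik2017, §3.7.4 eq. (3.68) (correlation length / mass gap); LiuStanley1972, p. 272 (ε = 0: independent layers)] -/
theorem layeredMassGap_zero_right {K : ℝ} (hK : 0 ≤ K) : layeredMassGap K 0 = massGap K 2 :=
  le_antisymm (layeredMassGap_le_massGap_two hK le_rfl)
    (iSup₂_le fun _ hm => ofReal_le_layeredMassGap (hasExponentialDecayRate_layered_zero_of_infTwoPoint hK hm))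

/-- For `0 ≤ K⊥`: `ξ^{3D}(K, K⊥) ≥ ξ^{3D}(K, 0) = ξ^{2D}(K)` — the 2D → 3D inequality of the tree factors through the
decoupled endpoint. [cite: Ginibre1970, Prop. 3 with Example 4 (plane rotators); LiuStanley1972, p. 272 (ε = 0)] -/
theorem layeredMassGap_le_layeredMassGap_zero_right {K Kz : ℝ} (hK : 0 ≤ K) (hz : 0 ≤ Kz) :
    layeredMassGap K Kz ≤ layeredMassGap K 0 :=
  layeredMassGap_anti hK le_rfl le_rfl hz

end MassGap

/-! ## §8 (appended) The limit `K⊥ → 0⁺`: Lieb numbers compute the mass gap, so `ξ^{3D}(K, K⊥) → ξ^{2D}(K)` -/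

section Limit

omit [MeasurableSpace Circle] [BorelSpace Circle] in
/-- A function with `ℓ^∞`-decay `|G(x)| ≤ C e^{−m‖x‖_∞}` has sphere sums `∑_{‖b‖_∞ = R} G(b) ≤ (2R+1)^ν · C · e^{−mR}`.
[cite: Simon1980CMP, Thm 1.3 (exponential decay summed over spheres) — plumbing] -/
theorem sum_sphere_le_of_abs_le_exp {ν : ℕ} {G : Site ν → ℝ} {C m : ℝ}
    (hG : ∀ x, |G x| ≤ C * Real.exp (-m * ‖x‖)) (R : ℕ) :
    ∑ b ∈ sphere ν R, G b ≤ (2 * R + 1) ^ ν * C * Real.exp (-m * R) := by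
  have hC0 : 0 ≤ C := by
    have h0 := hG 0
    rw [norm_zero, mul_zero, Real.exp_zero, mul_one] at h0
    exact (abs_nonneg _).trans h0
  have hterm : ∀ b ∈ sphere ν R, G b ≤ C * Real.exp (-m * R) := fun b hb => by
    have h := (le_abs_self (G b)).trans (hG b)
    rwa [Site.norm_eq_supNorm, mem_sphere.1 hb] at h
  calc ∑ b ∈ sphere ν R, G b ≤ #(sphere ν R) • (C * Real.exp (-m * R)) := Finset.sum_le_card_nsmul _ _ _ hterm
    _ = #(sphere ν R) * (C * Real.exp (-m * R)) := by rw [nsmul_eq_mul]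
    _ ≤ #(box ν R) * (C * Real.exp (-m * R)) := by
        refine mul_le_mul_of_nonneg_right ?_ (mul_nonneg hC0 (Real.exp_pos _).le)
        exact_mod_cast Finset.card_le_card (sphere_subset_box ν R)
    _ = (2 * R + 1) ^ ν * C * Real.exp (-m * R) := by rw [card_box]; push_cast; ring

omit [MeasurableSpace Circle] [BorelSpace Circle] in
/-- Polynomial versus exponential: for `0 ≤ C` and `μ < m`, eventually (in the radius `R`)
`(2R+1)²·C·e^{−mR} < e^{−μR}`. [folklore] -/
private theorem eventually_sq_mul_exp_lt {C m μ : ℝ} (hC : 0 ≤ C) (hμm : μ < m) :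
    ∀ᶠ R : ℕ in atTop, ((2 * R + 1) ^ 2 : ℝ) * C * Real.exp (-m * R) < Real.exp (-μ * R) := by
  set δ := m - μ with hδ_def
  have hδ : 0 < δ := sub_pos.2 hμm
  -- `(9C/δ²)·(δR)²·e^{−δR} → 0`
  have h1 : Tendsto (fun R : ℕ => 9 * C / δ ^ 2 * ((δ * R) ^ 2 * Real.exp (-(δ * R)))) atTop (𝓝 0) := by
    have h := ((Real.tendsto_pow_mul_exp_neg_atTop_nhds_zero 2).comp
      (tendsto_natCast_atTop_atTop.const_mul_atTop hδ)).const_mul (9 * C / δ ^ 2)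
    rw [mul_zero] at h
    exact h
  filter_upwards [h1.eventually_lt_const zero_lt_one, eventually_ge_atTop 1] with R hR hR1
  have hR1' : (1 : ℝ) ≤ R := by exact_mod_cast hR1
  have hsq : ((2 * R + 1) ^ 2 : ℝ) ≤ 9 * (R : ℝ) ^ 2 := by nlinarith
  have hkey : ((2 * R + 1) ^ 2 : ℝ) * C * Real.exp (-(δ * R)) < 1 := by
    calc ((2 * R + 1) ^ 2 : ℝ) * C * Real.exp (-(δ * R))
        ≤ 9 * (R : ℝ) ^ 2 * C * Real.exp (-(δ * R)) :=
          mul_le_mul_of_nonneg_right (mul_le_mul_of_nonneg_right hsq hC) (Real.exp_pos _).le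
      _ = 9 * C / δ ^ 2 * ((δ * R) ^ 2 * Real.exp (-(δ * R))) := by field_simp
      _ < 1 := hR
  calc ((2 * R + 1) ^ 2 : ℝ) * C * Real.exp (-m * R)
      = ((2 * R + 1) ^ 2 : ℝ) * C * Real.exp (-(δ * R)) * Real.exp (-μ * R) := by
        rw [mul_assoc (((2 * R + 1) ^ 2 : ℝ) * C), ← Real.exp_add]
        congr 2
        rw [hδ_def]; ring
    _ < 1 * Real.exp (-μ * R) := mul_lt_mul_of_pos_right hkey (Real.exp_pos _)
    _ = Real.exp (-μ * R) := one_mul _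

/-- **A cube number below `e^{−μR}` certifies the decay rate `μ` for the stack** (`K∥, K⊥ ≥ 0`, `R ≥ 1`, `μ > 0`):
`S_{(R,R,R)}(1; K∥, K⊥) ≤ e^{−μR} ⇒ G^{3D}(0, z) ≤ S^{⌊‖z‖_∞/R⌋} ≤ e^{μR}·e^{−μ‖z‖_∞}`.
[cite: Lieb1980, eq. (23) and p. 128 (boxes; φ(β) < 1 ⇒ exponential decay); Simon1980CMP, Thm 1.3] -/
theorem hasExponentialDecayRate_layered_of_cube_le_exp {Kp Kz μ : ℝ} (hp : 0 ≤ Kp) (hz : 0 ≤ Kz) {R : ℕ}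
    (hR : 1 ≤ R) (hμ : 0 < μ)
    (hS : aboxShellSum (fun u v : Site 3 => 1 / 2 * layeredCoupling Kp Kz u v) (fun _ : Fin 3 => R) ≤
      Real.exp (-(μ * R))) :
    HasExponentialDecayRate (fun z : Site 3 => infTwoPointLayered 1 Kp Kz 0 z) μ := by
  set a := aboxShellSum (fun u v : Site 3 => 1 / 2 * layeredCoupling Kp Kz u v) (fun _ : Fin 3 => R) with ha_def
  have ha0 : 0 ≤ a := aboxShellSum_nonneg (fun u v => mul_nonneg (by norm_num) (layeredCoupling_nonneg hp hz u v)) _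
  have hRpos : (0 : ℝ) < R := by exact_mod_cast hR
  refine ⟨hμ, Real.exp (μ * R), fun z => ?_⟩
  rw [abs_of_nonneg (infTwoPointLayered_nonneg zero_le_one hp hz 0 z), Site.norm_eq_supNorm]
  have h := infTwoPointLayered_le_pow_cube zero_le_one hp hz hR (0 : Site 3) z
  rw [zero_sub, Site.supNorm_neg] at h
  set n := Site.supNorm z with hn
  -- `R·⌊n/R⌋ ≥ n − R`
  have hdiv : (n : ℝ) - R ≤ R * ((n / R : ℕ) : ℝ) := by
    have hlt : (n : ℝ) < R * (((n / R : ℕ) : ℝ) + 1) := by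
      exact_mod_cast Nat.lt_mul_div_succ n (show 0 < R by omega)
    linarith
  calc infTwoPointLayered 1 Kp Kz 0 z ≤ a ^ (n / R) := h
    _ ≤ Real.exp (-(μ * R)) ^ (n / R) := pow_le_pow_left₀ ha0 hS _
    _ = Real.exp (-(μ * R) * ((n / R : ℕ) : ℝ)) := by rw [← Real.exp_nat_mul, mul_comm]
    _ ≤ Real.exp (-(μ * ((n : ℝ) - R))) := by
        rw [Real.exp_le_exp]
        nlinarith
    _ = Real.exp (μ * R) * Real.exp (-μ * (n : ℝ)) := by rw [← Real.exp_add]; ring_nf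

/-- **Lieb numbers compute the mass gap, uniformly in a small interlayer coupling.** Let `K ≥ 0` and let the layer
have the decay rate `m`: `|G^{2D}_K(0, x)| ≤ C e^{−m‖x‖_∞}`. Then for every `0 < μ < m` the free STACK has the decay
rate `μ` for all small `K⊥ ≥ 0`: `∀ᶠ K⊥ ∈ 𝓝[≥] 0, |G^{3D}_{(K,K⊥)}(0, z)| ≤ C' e^{−μ‖z‖_∞}`. Proof: a large square has
Lieb number `S_R(K) ≤ ∑_{‖b‖_∞ = R} G^{2D}_K(0, b) ≤ (2R+1)²·C·e^{−mR} < e^{−μR}` (Simon's form of the box number), this IS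
the stack's cube number at `K⊥ = 0` (`aboxShellSum_layered_zero_one`), the cube number is continuous in `K⊥`
(`continuous_layeredCube`), and a cube number `< e^{−μR}` certifies the rate `μ`.
[cite: Lieb1980, p. 128 (φ(β) < 1 for a box ⇒ exponential decay; "one can, in principle, compute β_c to arbitrary accuracy"); Simon1980CMP, Thm 1.3; LiuStanley1972, p. 272 (ε → 0)] -/
theorem eventually_hasExponentialDecayRate_layered_of_lt {K m μ : ℝ} (hK : 0 ≤ K)
    (hm : HasExponentialDecayRate (fun x : Site 2 => infTwoPoint K 2 0 x) m) (hμ : 0 < μ) (hμm : μ < m) :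
    ∀ᶠ Kz in 𝓝[≥] (0 : ℝ), HasExponentialDecayRate (fun z : Site 3 => infTwoPointLayered 1 K Kz 0 z) μ := by
  obtain ⟨_, C, hC⟩ := hm
  have hC0 : 0 ≤ C := by
    have h0 := hC 0
    rw [norm_zero, mul_zero, Real.exp_zero, mul_one] at h0
    exact (abs_nonneg _).trans h0
  -- a square whose Lieb number is below `e^{−μR}`
  obtain ⟨R, hRlt, hR1⟩ := ((eventually_sq_mul_exp_lt hC0 hμm).and (eventually_ge_atTop 1)).exists
  have hS2 : nnBoxShellSum K 2 R < Real.exp (-μ * R) :=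
    calc nnBoxShellSum K 2 R ≤ ∑ b ∈ sphere 2 R, infTwoPoint K 2 0 b := nnBoxShellSum_le_sum_sphere_infTwoPoint hK R
      _ ≤ (2 * R + 1) ^ 2 * C * Real.exp (-m * R) := sum_sphere_le_of_abs_le_exp hC R
      _ < Real.exp (-μ * R) := hRlt
  -- the cube number of the stack is continuous in `K⊥` and equals the square's at `K⊥ = 0`
  have hcont : Continuous fun Kz : ℝ =>
      aboxShellSum (fun u v : Site 3 => 1 / 2 * layeredCoupling K Kz u v) (fun _ : Fin 3 => R) := by
    refine continuous_aboxShellSum_comp (Jf := fun (Kz : ℝ) (u v : Site 3) => 1 / 2 * layeredCoupling K Kz u v)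
      (fun x y => continuous_const.mul ?_) _
    unfold layeredCoupling
    split_ifs
    · exact continuous_const
    · exact continuous_id
    · exact continuous_const
  have hS0 : aboxShellSum (fun u v : Site 3 => 1 / 2 * layeredCoupling K 0 u v) (fun _ : Fin 3 => R) <
      Real.exp (-μ * R) := by
    rw [aboxShellSum_layered_zero_one K hR1]
    exact hS2
  have hev : ∀ᶠ Kz in 𝓝 (0 : ℝ),
      aboxShellSum (fun u v : Site 3 => 1 / 2 * layeredCoupling K Kz u v) (fun _ : Fin 3 => R) < Real.exp (-μ * R) :=
    (hcont.tendsto 0).eventually_lt_const hS0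
  filter_upwards [nhdsWithin_le_nhds hev, self_mem_nhdsWithin] with Kz hKz hz0
  refine hasExponentialDecayRate_layered_of_cube_le_exp hK hz0 hR1 hμ ?_
  rw [← neg_mul]
  exact hKz.le

/-- **THE STACK'S CORRELATION LENGTH IS CONTINUOUS IN THE INTERLAYER COUPLING AT `K⊥ = 0`**: for every `K ≥ 0`,
`layeredMassGap K K⊥ → massGap K 2` as `K⊥ → 0⁺` — `ξ^{3D}(K, K⊥) → ξ^{2D}(K)`: from above by the antitone ceiling
`ξ^{3D}(K, K⊥) ≥ ξ^{2D}(K)` (Griffiths–Ginibre, tree `layeredMassGap_le_massGap_two`), from below because every rate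
`μ < m^{2D}(K)` is a rate of the stack for all small `K⊥` (`eventually_hasExponentialDecayRate_layered_of_lt`). At and above
`K_χ(2)` both sides are `0` (`ξ = ∞`) and the statement is the constancy of `∞`.
[cite: LiuStanley1972, p. 272 (T_c(ε) of the layers (J, J, εJ) as ε → 0); Lieb1980, p. 128 (finite algorithm); Simon1980CMP, Thm 1.3; Ginibre1970, Prop. 3] -/
theorem tendsto_layeredMassGap_nhdsGE_zero {K : ℝ} (hK : 0 ≤ K) :
    Tendsto (fun Kz : ℝ => layeredMassGap K Kz) (𝓝[≥] 0) (𝓝 (massGap K 2)) := by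
  rw [tendsto_order]
  refine ⟨fun a ha => ?_, fun a ha => ?_⟩
  · -- lower semicontinuity: `a < m^{2D}` is eventually below `m^{3D}(K, K⊥)`
    unfold massGap at ha
    obtain ⟨m, hm⟩ := lt_iSup_iff.1 ha
    obtain ⟨hrate, ham⟩ := lt_iSup_iff.1 hm
    have ha_top : a ≠ ⊤ := ne_top_of_lt ham
    have ham' : a.toReal < m := ENNReal.toReal_lt_of_lt_ofReal ham
    set μ := (a.toReal + m) / 2 with hμ_def
    have hμm : μ < m := by rw [hμ_def]; linarith
    have hμ0 : 0 < μ := by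
      have := hrate.1
      have h0 : 0 ≤ a.toReal := ENNReal.toReal_nonneg
      rw [hμ_def]; linarith
    have haμ : a < ENNReal.ofReal μ := by
      rw [← ENNReal.ofReal_toReal ha_top, ENNReal.ofReal_lt_ofReal_iff hμ0, hμ_def]
      linarith
    exact (eventually_hasExponentialDecayRate_layered_of_lt hK hrate hμ0 hμm).mono
      fun Kz h => lt_of_lt_of_le haμ (ofReal_le_layeredMassGap h)
  · -- the antitone ceiling `m^{3D}(K, K⊥) ≤ m^{2D}(K)` for `K⊥ ≥ 0`
    exact eventually_nhdsWithin_of_forall fun Kz hz => lt_of_le_of_lt (layeredMassGap_le_massGap_two hK hz) ha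

/-- The same along `K⊥ → 0` through positive values. [cite: LiuStanley1972, p. 272 (ε → 0); Lieb1980, p. 128; Simon1980CMP, Thm 1.3] -/
theorem tendsto_layeredMassGap_nhdsGT_zero {K : ℝ} (hK : 0 ≤ K) :
    Tendsto (fun Kz : ℝ => layeredMassGap K Kz) (𝓝[>] 0) (𝓝 (massGap K 2)) :=
  (tendsto_layeredMassGap_nhdsGE_zero hK).mono_left (nhdsWithin_mono _ Set.Ioi_subset_Ici_self)

/-- `K⊥ ↦ ξ^{3D}(K, K⊥)` is (right-)continuous at `K⊥ = 0` on `[0, ∞)`, with the value `ξ^{2D}(K)` there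
(`layeredMassGap_zero_right`). [cite: LiuStanley1972, p. 272 (ε → 0); Lieb1980, p. 128; Simon1980CMP, Thm 1.3] -/
theorem continuousWithinAt_layeredMassGap_Ici_zero {K : ℝ} (hK : 0 ≤ K) :
    ContinuousWithinAt (fun Kz : ℝ => layeredMassGap K Kz) (Set.Ici 0) 0 := by
  change Tendsto (fun Kz : ℝ => layeredMassGap K Kz) (𝓝[≥] 0) (𝓝 (layeredMassGap K 0))
  rw [layeredMassGap_zero_right hK]
  exact tendsto_layeredMassGap_nhdsGE_zero hK

/-- **Every correlation-length ceiling of the layer survives a small interlayer coupling**: if `a < m^{2D}(K)`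
(`ξ^{2D}(K) < 1/a`) then `a < m^{3D}(K, K⊥)` (`ξ^{3D}(K, K⊥) < 1/a`) for all small `K⊥ ≥ 0`.
[cite: LiuStanley1972, p. 272 (ε → 0); Lieb1980, p. 128 (finite algorithm); Simon1980CMP, Thm 1.3] -/
theorem eventually_lt_layeredMassGap_of_lt_massGap {K : ℝ} (hK : 0 ≤ K) {a : ℝ≥0∞} (ha : a < massGap K 2) :
    ∀ᶠ Kz in 𝓝[≥] (0 : ℝ), a < layeredMassGap K Kz :=
  (tendsto_order.1 (tendsto_layeredMassGap_nhdsGE_zero hK)).1 a ha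

/-- Temperature form (`J∥ ≥ 0`, `T > 0`): `ξ^{3D}(J∥/T, J⊥/T) → ξ^{2D}(J∥/T)` as `J⊥ → 0⁺` at fixed temperature — the
correlation-length face of the layered crossover `T_c^{3D}(J∥, J⊥) ↓ T^{2D}(J∥)`; nothing is asserted about the rate
of approach. [cite: LiuStanley1972, p. 272 (T_c(ε) → T_c(0) of the layers (J, J, εJ)); Lieb1980, p. 128; Simon1980CMP, Thm 1.3] -/
theorem tendsto_layeredMassGap_temperature {J T : ℝ} (hJ : 0 ≤ J) (hT : 0 < T) :
    Tendsto (fun Jz : ℝ => layeredMassGap (J / T) (Jz / T)) (𝓝[≥] 0) (𝓝 (massGap (J / T) 2)) := by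
  have hdiv : Tendsto (fun Jz : ℝ => Jz / T) (𝓝[≥] (0 : ℝ)) (𝓝[≥] 0) := by
    refine tendsto_nhdsWithin_of_tendsto_nhds_of_eventually_within _ ?_ ?_
    · have h : Tendsto (fun Jz : ℝ => Jz / T) (𝓝 0) (𝓝 0) := by
        simpa using ((continuous_id.div_const T).tendsto (0 : ℝ))
      exact h.mono_left nhdsWithin_le_nhds
    · exact eventually_nhdsWithin_of_forall fun Jz (hz : 0 ≤ Jz) => div_nonneg hz hT.le
  exact (tendsto_layeredMassGap_nhdsGE_zero (div_nonneg hJ hT.le)).comp hdiv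

/-- **The massive phase of the stack is open in the couplings** (rider): if `0 < m^{3D}(K∥, K⊥)` at `K∥, K⊥ ≥ 0` then
`0 < m^{3D}` on a neighbourhood in `[0, ∞)²` — the tree's openness of the stack's high-temperature phase
(`exists_nhds_summable_layered`) read through `layeredMassGap_pos_iff_summable`.
[cite: Simon1980CMP, Thm 1.3 (Σ < ∞ ⇔ exponential decay); Lieb1980, p. 128 (φ(β) < 1 is an open condition)] -/
theorem exists_nhds_layeredMassGap_pos {Kp Kz : ℝ} (hp : 0 ≤ Kp) (hz : 0 ≤ Kz) (h : 0 < layeredMassGap Kp Kz) :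
    ∃ ε : ℝ, 0 < ε ∧ ∀ ⦃Kp' Kz' : ℝ⦄, 0 ≤ Kp' → 0 ≤ Kz' → Kp' < Kp + ε → Kz' < Kz + ε →
      0 < layeredMassGap Kp' Kz' := by
  obtain ⟨ε, hε, hεs⟩ := exists_nhds_summable_layered hp hz ((layeredMassGap_pos_iff_summable hp hz).1 h)
  exact ⟨ε, hε, fun Kp' Kz' hp' hz' h1 h2 => (layeredMassGap_pos_iff_summable hp' hz').2 (hεs hp' hz' h1 h2)⟩

end Limit

end PlaneRotator

end Literature.Probability.LatticeModels
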